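import Summits.CriticalPhenomena.Ising3DConformalLimit.Theses.AnomalousForcesInteraction
import Summits.CriticalPhenomena.Ising3DConformalLimit.Theorems.LatticeSDPCertificatesWindowBelowHalf
import Summits.CriticalPhenomena.Ising3DConformalLimit.Theorems.GaussianLimitNotScreened.Negative.Reformulation

/-!
# Strategist regime split of crux `GaussianLimitIsFree` (item stmt-CriticalPhenomena-2601)

Kernel-checked bookkeeping for the strategy census (seat `cstrat-stmt-CriticalPhenomena-2601-s1`).
By `dimension_window_and_eta` every non-degenerate scale-covariant pointwise limit of `criticalCorr 3`
has `Δ ∈ [1/2, 3/4]` and `η = 2Δ - 1` exists, so the crux ("a Gaussian limit has `Δ = 1/2`") is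
EQUIVALENT to the conjunction of

* `GaussianExcludesOpenWindow` — no Gaussian limit with `1/2 < Δ < 3/4` (the regime NOT witnessed by the
  long-range barrier `LongRangeTrivialityOnZ3`, which produces Gaussian limits only for `Δ ≥ 3/4`);
* `GaussianExcludesCorner` — no Gaussian limit with `Δ = 3/4` (the marginal corner `η = 1/2`).

The corner is discharged by the EXISTING lattice item stmt-CriticalPhenomena-5507 `WindowBelowHalf`
(strict `η_eff < 1/2` between scales; verdict open-problem) via `isingEta_lt_half_of_windowBelowHalf`.
No `sorry`. This file is evidence, not a route edit: neither piece has a plan distinct from the parent's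
Markov-inheritance line (see STRATEGY-CENSUS.md §Decomposition).
-/

namespace Summit.CriticalPhenomena.Ising3DConformalLimit.Theorems.GaussianLimitIsFreeSplit

open Literature.Probability.LatticeModels
open Summit.CriticalPhenomena.Ising3DConformalLimit.Theses.AnomalousForcesInteraction (GaussianLimitIsFree)
open Summit.CriticalPhenomena.Ising3DConformalLimit.Theses.LatticeSDPCertificates (WindowBelowHalf)
open Summit.CriticalPhenomena.Ising3DConformalLimit.GaussianLimitNotScreenedNegative
  (dimension_window_and_eta)

/-- Sub₁ (bulk of the window): a Gaussian (U₄ ≡ 0) non-degenerate scale-covariant pointwise limit of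
critical Ising₃ cannot have its dimension strictly inside `(1/2, 3/4)`. -/
def GaussianExcludesOpenWindow : Prop :=
  ∀ (ρ : ℝ → ℝ) (Δ : ℝ) (S : CorrFamily 3), (∀ δ ∈ Set.Ioc (0:ℝ) 1, 0 < ρ δ) →
    HasPointwiseScalingLimit (criticalCorr 3) ρ S → IsNondegenerateTwoPoint S →
    IsTranslationInvariant S → IsScaleCovariant Δ S → ¬ HasNontrivialU4 S →
    ¬ (1 / 2 < Δ ∧ Δ < 3 / 4)

/-- Sub₂ (marginal corner): such a Gaussian limit cannot have `Δ = 3/4` (`η = 1/2`). -/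
def GaussianExcludesCorner : Prop :=
  ∀ (ρ : ℝ → ℝ) (Δ : ℝ) (S : CorrFamily 3), (∀ δ ∈ Set.Ioc (0:ℝ) 1, 0 < ρ δ) →
    HasPointwiseScalingLimit (criticalCorr 3) ρ S → IsNondegenerateTwoPoint S →
    IsTranslationInvariant S → IsScaleCovariant Δ S → ¬ HasNontrivialU4 S →
    Δ ≠ 3 / 4

/-- Glue: the two regime pieces give the crux BY NAME (window `[1/2, 3/4]` from the tree). -/
theorem GaussianLimitIsFree_of_subs
    (h₁ : GaussianExcludesOpenWindow) (h₂ : GaussianExcludesCorner) : GaussianLimitIsFree := by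
  intro ρ Δ S hρ hlim hnd htr hsc hU
  have hw := (dimension_window_and_eta hρ hlim hnd hsc).1
  have hno := h₁ ρ Δ S hρ hlim hnd htr hsc hU
  have hne := h₂ ρ Δ S hρ hlim hnd htr hsc hU
  rcases hw with ⟨hlo, hhi⟩
  by_contra hhalf
  have hgt : 1 / 2 < Δ := lt_of_le_of_ne hlo (fun h => hhalf h.symm)
  have hlt : Δ < 3 / 4 := lt_of_le_of_ne hhi hne
  exact hno ⟨hgt, hlt⟩

/-- Converse: the crux gives both pieces (so the split is an equivalence, not a weakening). -/
theorem subs_of_GaussianLimitIsFree (h : GaussianLimitIsFree) :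
    GaussianExcludesOpenWindow ∧ GaussianExcludesCorner := by
  refine ⟨?_, ?_⟩
  · intro ρ Δ S hρ hlim hnd htr hsc hU hwin
    have := h ρ Δ S hρ hlim hnd htr hsc hU
    rcases hwin with ⟨hgt, -⟩
    rw [this] at hgt
    exact lt_irrefl _ hgt
  · intro ρ Δ S hρ hlim hnd htr hsc hU h34
    have := h ρ Δ S hρ hlim hnd htr hsc hU
    rw [this] at h34
    norm_num at h34

theorem GaussianLimitIsFree_iff_subs :
    GaussianLimitIsFree ↔ (GaussianExcludesOpenWindow ∧ GaussianExcludesCorner) :=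
  ⟨subs_of_GaussianLimitIsFree, fun h => GaussianLimitIsFree_of_subs h.1 h.2⟩

/-- The corner piece is paid by the existing lattice item 5507 `WindowBelowHalf` (no Gaussianity used):
`η = 2Δ - 1` exists for any such limit and `WindowBelowHalf` forces `η < 1/2`. -/
theorem gaussianExcludesCorner_of_windowBelowHalf (hW : WindowBelowHalf) : GaussianExcludesCorner := by
  intro ρ Δ S hρ hlim hnd _htr hsc _hU h34
  have hη := (dimension_window_and_eta hρ hlim hnd hsc).2
  have hlt := isingEta_lt_half_of_windowBelowHalf hW hη
  rw [h34] at hlt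
  norm_num at hlt

/-- Hence: crux ⟸ (bulk-of-window piece) ∧ item 5507. -/
theorem GaussianLimitIsFree_of_openWindow_of_windowBelowHalf
    (h₁ : GaussianExcludesOpenWindow) (hW : WindowBelowHalf) : GaussianLimitIsFree :=
  GaussianLimitIsFree_of_subs h₁ (gaussianExcludesCorner_of_windowBelowHalf hW)

end Summit.CriticalPhenomena.Ising3DConformalLimit.Theorems.GaussianLimitIsFreeSplit
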